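import Summits.ValiantsHypothesis.ValiantsHypothesis.Theorems.AnyonJetsJetConstantElimVP0Collapse
import Summits.ValiantsHypothesis.ValiantsHypothesis.Theorems.AnyonJetsJetConstantElimMultiplierBypassNamed
import Summits.ValiantsHypothesis.ValiantsHypothesis.Theorems.AnyonJetsJetConstantElimIntegralMultipleCalibration

/-!
# AnyonJets — `VP⁰ = VNP⁰` versus the OTHER open stubs: `stub_integralMultiple` (line `birth` of
# crux 16737) and `stub_integralMultiple₂ = ∃ b₁, IntegralMultipleTwoAdicWith b₁` (the one open
# stub of the binder crux `JetConstantElimTwoAdic`, stmt-23655)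

Both stubs ask, given a near-optimal `ℚ̄`-circuit `Q` for `J_(n,k)`, for an INTEGER circuit of
polynomially related size and height computing some multiple `M·J_(n,k)` (the second also with
`v₂(M)` polynomially bounded).  Under a uniform constant-free bound `τ(J_(n,k)) ≤ (n+2)^c`
(which `VP⁰ = VNP⁰` provides: `uniformTau_of_vp0EqVNP0`, `AnyonJetsJetConstantElimVP0Collapse.lean`)
they hold TRIVIALLY, ignoring `Q`: take a `τ`-optimal constant-free circuit for `J_(n,k)` itself
(`M = 1`, height `t = 0`, all constants and coefficients in `{0, 1, -1}`).

* (height clauses with `t = 0` for a circuit with sign constants: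
  `heightBound_zero_of_hasSignConstants`, landed in `…IntegralMultipleCalibration.lean`);
* `integralMultipleTwoAdicWith_of_uniformTau`, `integralMultiple_of_uniformTau` — uniform
  `τ`-cheapness of the jets gives both stubs (exponent `c + 2`);
* `integralMultipleTwoAdicWith_of_vp0EqVNP0`, `integralMultiple_of_vp0EqVNP0` — hence
  **`VP⁰ = VNP⁰ ⟹` both stubs**; contrapositives `not_vp0EqVNP0_of_not_integralMultipleTwoAdicWith`,
  `not_vp0EqVNP0_of_not_integralMultiple`: **a refutation of either stub proves `VP⁰ ≠ VNP⁰`**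
  (sharper: `τ(P_n) ≠ n^{O(1)}` for the inversion pencil, `not_isPBounded_tau_pencil_of_not_…`).

So every open stub of both CE-side lines (`birth` of 16737: integralMultiple, multiplierRemoval;
the bypass line of 23655: integralMultiple₂) is refutable only by separating `VP⁰` from `VNP⁰`.
Honest framing: conditional implications; the stubs stay OPEN; VP ≠ VNP is NOT proved or moved.
-/

noncomputable section

-- single-conjunct layout: Sub = Summit, duplicated namespace component intended
set_option linter.dupNamespace false

namespace Summit.ValiantsHypothesis.ValiantsHypothesis.Theorems.AnyonJets.JetConstantElim

open MvPolynomial Finset Literature.Computability.AlgebraicComplexity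
open Literature.Barriers.ValiantsHypothesis (VP0EqVNP0)
open Summit.ValiantsHypothesis.ValiantsHypothesis.Theses.AnyonJets
open Summit.ValiantsHypothesis.ValiantsHypothesis.Theorems.AnyonJets.ConstantFreeJetGrowth (jet)

/-! ### Bookkeeping -/

/-- Arithmetic: `X^c + 2 ≤ X^(c+2)` for `X ≥ 2`. [folklore] -/
theorem pow_add_two_le (X c : ℕ) (hX : 2 ≤ X) : X ^ c + 2 ≤ X ^ (c + 2) := by
  have h1 : 1 ≤ X ^ c := Nat.one_le_pow _ _ (by omega)
  have h4 : 4 ≤ X ^ 2 := by nlinarith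
  calc X ^ c + 2 ≤ X ^ c * 4 := by omega
    _ ≤ X ^ c * X ^ 2 := Nat.mul_le_mul_left _ h4
    _ = X ^ (c + 2) := by rw [← pow_add]

/-! ### Uniformly cheap jets give both stubs trivially -/

/-- **Uniform `τ`-cheapness of the jets gives `stub_integralMultiple₂`** (`∃ b₁,
IntegralMultipleTwoAdicWith b₁`, the one open stub of crux 23655): ignore the given `ℚ̄`-circuit
and take a `τ`-optimal constant-free circuit for `J_(n,k)` (`M = 1`, `t = 0`, `v₂(1) = 0`).
[cite: KoiranPerifel2011, Rem. 4] -/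
theorem integralMultipleTwoAdicWith_of_uniformTau
    (hU : ∃ c : ℕ, ∀ n k : ℕ, constantFreeComplexity (jet n k) ≤ (n + 2) ^ c) :
    ∃ b₁ : ℕ, IntegralMultipleTwoAdicWith b₁ := by
  obtain ⟨c, hc⟩ := hU
  refine ⟨c + 2, fun n k _ Q _ _ => ?_⟩
  obtain ⟨P, h2, hS, hC, hsz⟩ :=
    ArithCircuit.exists_computes_size_eq_constantFreeComplexity (jet n k)
  refine ⟨P, 0, 1, le_rfl, h2, ?_, heightBound_zero_of_hasSignConstants hS, ?_, by simp⟩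
  · rw [Nat.cast_one, one_smul]; exact hC
  · have hX : 2 ≤ Q.size + n + 2 := by omega
    calc P.size + 0 + 2 = constantFreeComplexity (jet n k) + 2 := by rw [hsz, Nat.add_zero]
      _ ≤ (n + 2) ^ c + 2 := Nat.add_le_add_right (hc n k) 2
      _ ≤ (Q.size + n + 2) ^ c + 2 :=
          Nat.add_le_add_right (Nat.pow_le_pow_left (by omega) _) 2
      _ ≤ (Q.size + n + 2) ^ (c + 2) := pow_add_two_le _ c hX

/-- **Uniform `τ`-cheapness of the jets gives `stub_integralMultiple`** (registered signature of
line `birth`, crux 16737, verbatim). [cite: KoiranPerifel2011, Rem. 4] -/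
theorem integralMultiple_of_uniformTau
    (hU : ∃ c : ℕ, ∀ n k : ℕ, constantFreeComplexity (jet n k) ≤ (n + 2) ^ c) :
    let J := fun (n k : ℕ) => (∑ σ : Equiv.Perm (Fin n), MvPolynomial.C (((Equiv.Perm.sign σ : ℤˣ) : ℤ) * (((Finset.univ.filter (fun p : Fin n × Fin n => p.1 < p.2 ∧ σ p.2 < σ p.1)).card.choose k : ℕ) : ℤ)) * ∏ i : Fin n, MvPolynomial.X (σ i, i) : MvPolynomial (Fin n × Fin n) ℤ);
    ∃ b₁ : ℕ, ∀ n k : ℕ, k ≤ Nat.log 2 n →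
      ∀ Q : Literature.Computability.AlgebraicComplexity.ArithCircuit (AlgebraicClosure ℚ) (Fin n × Fin n),
        Q.IsFanInTwo →
        Q.Computes (MvPolynomial.map (Int.castRingHom (AlgebraicClosure ℚ)) (J n k)) →
        ∃ (P : Literature.Computability.AlgebraicComplexity.ArithCircuit ℤ (Fin n × Fin n)) (t M : ℕ),
          1 ≤ M ∧ P.IsFanInTwo ∧ P.Computes ((M : ℤ) • J n k) ∧
          ((∀ g ∈ P.gates, ∀ u ∈ g.args, ∀ c : ℤ, u = .const c → c.natAbs ≤ 2 ^ t) ∧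
            (∀ args : List (ℤ × Literature.Computability.AlgebraicComplexity.ArithCircuit.Operand ℤ (Fin n × Fin n)),
              Literature.Computability.AlgebraicComplexity.ArithCircuit.Gate.sum args ∈ P.gates →
                ∀ a ∈ args, a.1.natAbs ≤ 2 ^ t) ∧
            (∀ c : ℤ, P.output = .const c → c.natAbs ≤ 2 ^ t)) ∧
          P.size + t + 2 ≤ (Q.size + n + 2) ^ b₁ :=
  integralMultiple_of_integralMultipleTwoAdicWith (integralMultipleTwoAdicWith_of_uniformTau hU)

/-! ### Under `VP⁰ = VNP⁰` -/

/-- **`VP⁰ = VNP⁰ ⟹ stub_integralMultiple₂`** (the open stub of the binder crux 23655).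
[cite: KoiranPerifel2011, Rem. 4] -/
theorem integralMultipleTwoAdicWith_of_vp0EqVNP0 (h : VP0EqVNP0) :
    ∃ b₁ : ℕ, IntegralMultipleTwoAdicWith b₁ :=
  integralMultipleTwoAdicWith_of_uniformTau (uniformTau_of_vp0EqVNP0 h)

/-- **`VP⁰ = VNP⁰ ⟹ stub_integralMultiple`** (line `birth` of crux 16737, signature verbatim).
[cite: KoiranPerifel2011, Rem. 4] -/
theorem integralMultiple_of_vp0EqVNP0 (h : VP0EqVNP0) :
    let J := fun (n k : ℕ) => (∑ σ : Equiv.Perm (Fin n), MvPolynomial.C (((Equiv.Perm.sign σ : ℤˣ) : ℤ) * (((Finset.univ.filter (fun p : Fin n × Fin n => p.1 < p.2 ∧ σ p.2 < σ p.1)).card.choose k : ℕ) : ℤ)) * ∏ i : Fin n, MvPolynomial.X (σ i, i) : MvPolynomial (Fin n × Fin n) ℤ);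
    ∃ b₁ : ℕ, ∀ n k : ℕ, k ≤ Nat.log 2 n →
      ∀ Q : Literature.Computability.AlgebraicComplexity.ArithCircuit (AlgebraicClosure ℚ) (Fin n × Fin n),
        Q.IsFanInTwo →
        Q.Computes (MvPolynomial.map (Int.castRingHom (AlgebraicClosure ℚ)) (J n k)) →
        ∃ (P : Literature.Computability.AlgebraicComplexity.ArithCircuit ℤ (Fin n × Fin n)) (t M : ℕ),
          1 ≤ M ∧ P.IsFanInTwo ∧ P.Computes ((M : ℤ) • J n k) ∧
          ((∀ g ∈ P.gates, ∀ u ∈ g.args, ∀ c : ℤ, u = .const c → c.natAbs ≤ 2 ^ t) ∧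
            (∀ args : List (ℤ × Literature.Computability.AlgebraicComplexity.ArithCircuit.Operand ℤ (Fin n × Fin n)),
              Literature.Computability.AlgebraicComplexity.ArithCircuit.Gate.sum args ∈ P.gates →
                ∀ a ∈ args, a.1.natAbs ≤ 2 ^ t) ∧
            (∀ c : ℤ, P.output = .const c → c.natAbs ≤ 2 ^ t)) ∧
          P.size + t + 2 ≤ (Q.size + n + 2) ^ b₁ :=
  integralMultiple_of_uniformTau (uniformTau_of_vp0EqVNP0 h)

/-- **A refutation of `stub_integralMultiple₂` (crux 23655's open stub) proves `VP⁰ ≠ VNP⁰`.**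
[cite: KoiranPerifel2011, Rem. 4] -/
theorem not_vp0EqVNP0_of_not_integralMultipleTwoAdicWith
    (hI : ¬ ∃ b₁ : ℕ, IntegralMultipleTwoAdicWith b₁) : ¬ VP0EqVNP0 :=
  fun h => hI (integralMultipleTwoAdicWith_of_vp0EqVNP0 h)

/-- **A refutation of `stub_integralMultiple` (line `birth`, crux 16737) proves `VP⁰ ≠ VNP⁰`.**
[cite: KoiranPerifel2011, Rem. 4] -/
theorem not_vp0EqVNP0_of_not_integralMultiple
    (hI : ¬ (let J := fun (n k : ℕ) => (∑ σ : Equiv.Perm (Fin n), MvPolynomial.C (((Equiv.Perm.sign σ : ℤˣ) : ℤ) * (((Finset.univ.filter (fun p : Fin n × Fin n => p.1 < p.2 ∧ σ p.2 < σ p.1)).card.choose k : ℕ) : ℤ)) * ∏ i : Fin n, MvPolynomial.X (σ i, i) : MvPolynomial (Fin n × Fin n) ℤ);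
      ∃ b₁ : ℕ, ∀ n k : ℕ, k ≤ Nat.log 2 n →
        ∀ Q : Literature.Computability.AlgebraicComplexity.ArithCircuit (AlgebraicClosure ℚ) (Fin n × Fin n),
          Q.IsFanInTwo →
          Q.Computes (MvPolynomial.map (Int.castRingHom (AlgebraicClosure ℚ)) (J n k)) →
          ∃ (P : Literature.Computability.AlgebraicComplexity.ArithCircuit ℤ (Fin n × Fin n)) (t M : ℕ),
            1 ≤ M ∧ P.IsFanInTwo ∧ P.Computes ((M : ℤ) • J n k) ∧
            ((∀ g ∈ P.gates, ∀ u ∈ g.args, ∀ c : ℤ, u = .const c → c.natAbs ≤ 2 ^ t) ∧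
              (∀ args : List (ℤ × Literature.Computability.AlgebraicComplexity.ArithCircuit.Operand ℤ (Fin n × Fin n)),
                Literature.Computability.AlgebraicComplexity.ArithCircuit.Gate.sum args ∈ P.gates →
                  ∀ a ∈ args, a.1.natAbs ≤ 2 ^ t) ∧
              (∀ c : ℤ, P.output = .const c → c.natAbs ≤ 2 ^ t)) ∧
            P.size + t + 2 ≤ (Q.size + n + 2) ^ b₁)) :
    ¬ VP0EqVNP0 :=
  fun h => hI (integralMultiple_of_vp0EqVNP0 h)

end Summit.ValiantsHypothesis.ValiantsHypothesis.Theorems.AnyonJets.JetConstantElim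

end
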